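import Summits.ABC.ABC.Theses.RibetTakahashiSplit
import Literature.NumberTheory.EllipticCurves.LFunctionCoefficientBound
import Literature.NumberTheory.DiophantineGeometry.ConductorRadicalProofs

/-!
# Stub `stub_depthResidual` of line `switching-triangle` (crux stmt-ABC-1563): reductions to the
# hasse-pinning depth half

Helper (`--supports stmt-ABC-1563`) for the registered stub

  `stub_depthResidual : ∀ ε > 0, ∃ C, ∀ W [IsElliptic], H_sf → H_card → ¬ Squarefree N → ¬ Frey →
    Mult(W).Nonempty → G(W) ≤ C · N^ε`

of the line `switching-triangle` for the crux
`Summit.ABC.ABC.Theses.RibetTakahashiSplit.FewPrimeValuationProduct`. Notation: `N = W.conductorNorm ℤ`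
is the conductor, `Mult(W) = {p ∣ N prime : p² ∤ N}` the set of multiplicative primes,
`c_p = (W.minimalDiscriminantNorm ℤ).factorization p = ord_p Δ_min`, the DEPTH
`G(W) = gcd_{p ∈ Mult(W)} c_p`, `a_v(W) = W.LFunction v` (Mathlib's `WeierstrassCurve.LFunction`);
H_sf is "`p² ∤ N` for odd `p`" (semistable away from `2`), H_card is "`≤ 3` odd multiplicative primes".

Three registered REDUCTIONS are proved here (the open content stays in the hypotheses):

* `depthResidual_depthBound_of_hasse` — the aggregation of the sibling line
  `hasse-pinning-fixed-level` (its `depthBound_of`, ported): fixed-level congruence (hyp 1) +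
  least distinguishing prime (hyp 2) + small-prime depth (hyp 3) ⟹ every COMMON divisor `d` of the
  `c_p`, `p ∈ Mult(W)`, is `≤ C_ε N^ε` on the crux class. Proof: write `d = ∏ ℓ^{k_ℓ}`; a prime
  `ℓ < ℓ₀` contributes `≤ B(ℓ)` (hyp 3); for `ℓ ≥ ℓ₀` hyp 1 pins `W mod ℓ^{k_ℓ}` to a partner `W₀` in
  the finite set `S`, hyp 2 gives a good prime `v ≤ C N^{ε'}` with `a_v(W) ≠ a_v(W₀)`, and all the
  `ℓ^{k_ℓ}` with the same partner divide the non-zero integer `a_v(W) − a_v(W₀)`, of absolute value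
  `≤ 4v` by Hasse (`WeierstrassCurve.abs_LFunction_prime_pow_le` with `k = 1`); so their product is
  `≤ 4 C N^{ε'}`, and the product over the `≤ #S` partners is `≤ (∏ 4 C_{W₀}) N^{ε' #S}`,
  `ε' = ε / (#S + 1)`.
* `stub_depthResidual_of_depthBound` — the depth bound (all common divisors) ⟹ the stub, with
  `d := G(W)` (`Finset.gcd_dvd`); the positivity `0 < c_p` on `Mult(W)` holds for elliptic `W` since
  `primeFactors N = primeFactors Δ_min` (`WeierstrassCurve.radical_conductorNorm_eq_holds`); the
  hypotheses `¬ Squarefree N` and "not a twisted Frey curve" are not used.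
* `stub_depthResidual_of_hasse` — the composition of the two.

Not here: any attempt at the three hasse-pinning statements themselves (fixed-level congruence,
least distinguishing prime, small-prime depth), which stay hypotheses.
-/

-- `Summit.<Summit>.<Problem>` is the mandated summit-side namespace (CONVENTIONS §2); for the
-- single-conjunct summit `ABC` the two coincide, so the duplicate `ABC.ABC` is deliberate.
set_option linter.dupNamespace false

namespace Summit.ABC.ABC.Theorems.FewPrimeValuationProduct

/-- Distinct prime powers each dividing `n ≠ 0` divide it jointly (comparison of factorizations).
`[folklore]` -/
theorem depthResidual_prod_primePow_dvd {T : Finset ℕ} (hT : ∀ ℓ ∈ T, ℓ.Prime) (k : ℕ → ℕ) {n : ℕ}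
    (hn : n ≠ 0) (h : ∀ ℓ ∈ T, ℓ ^ k ℓ ∣ n) : ∏ ℓ ∈ T, ℓ ^ k ℓ ∣ n := by
  -- adapted from `Cruxes/FewPrimeValuationProduct/Lines/hasse_pinning_fixed_level.lean`
  have hP0 : ∏ ℓ ∈ T, ℓ ^ k ℓ ≠ 0 :=
    Finset.prod_ne_zero_iff.mpr fun ℓ hℓ => pow_ne_zero _ (hT ℓ hℓ).ne_zero
  rw [← Nat.factorization_le_iff_dvd hP0 hn,
    Nat.factorization_prod fun ℓ hℓ => pow_ne_zero _ (hT ℓ hℓ).ne_zero]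
  intro q
  rw [Finsupp.finsetSum_apply,
    Finset.sum_congr rfl fun ℓ hℓ => by rw [(hT ℓ hℓ).factorization_pow]]
  simp only [Finsupp.single_apply]
  rw [Finset.sum_ite_eq']
  split_ifs with hq
  · exact ((hT q hq).pow_dvd_iff_le_factorization hn).mp (h q hq)
  · exact Nat.zero_le _

/-- Hasse in the form used here: `|a_v(W)| ≤ 2√v ≤ 2v` at a prime `v` (from the tree's
`WeierstrassCurve.abs_LFunction_prime_pow_le`, `k = 1`). `[folklore]` -/
theorem depthResidual_abs_LFunction_prime_le (W : WeierstrassCurve ℚ) [W.IsElliptic] {v : ℕ}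
    (hv : v.Prime) : |(W.LFunction v : ℝ)| ≤ 2 * v := by
  have h := W.abs_LFunction_prime_pow_le hv 1
  simp only [pow_one] at h
  norm_num at h
  have h1 : (1 : ℝ) ≤ v := by exact_mod_cast hv.one_lt.le
  have hs : Real.sqrt v ≤ v := by
    calc Real.sqrt v ≤ Real.sqrt ((v : ℝ) ^ 2) := Real.sqrt_le_sqrt (by nlinarith)
      _ = v := Real.sqrt_sq (by positivity)
  linarith

/-- Every `c_p`, `p ∈ Mult(W)`, is positive for an elliptic `W`: a prime of the conductor divides the
minimal discriminant (`primeFactors N = primeFactors Δ_min`, equality of radicals,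
`WeierstrassCurve.radical_conductorNorm_eq_holds`, Silverman AEC VIII.11). `[folklore]` -/
theorem depthResidual_factorization_pos (W : WeierstrassCurve ℚ) [W.IsElliptic] {p : ℕ}
    (hp : p ∈ (W.conductorNorm ℤ).primeFactors.filter (fun p => ¬ p ^ 2 ∣ W.conductorNorm ℤ)) :
    0 < (W.minimalDiscriminantNorm ℤ).factorization p := by
  have hrad : UniqueFactorizationMonoid.radical (W.conductorNorm ℤ) =
      UniqueFactorizationMonoid.radical (W.minimalDiscriminantNorm ℤ) :=
    W.radical_conductorNorm_eq_holds
  have hpf : (W.conductorNorm ℤ).primeFactors = (W.minimalDiscriminantNorm ℤ).primeFactors := by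
    rw [← Nat.primeFactors_radical, hrad, Nat.primeFactors_radical]
  have hp1 : p ∈ (W.conductorNorm ℤ).primeFactors := (Finset.mem_filter.mp hp).1
  rw [hpf] at hp1
  obtain ⟨hpp, hpd, hne⟩ := Nat.mem_primeFactors.mp hp1
  exact hpp.factorization_pos_of_dvd hne hpd

/-- **Aggregation (registered sub-goal `depthResidual_depthBound_of_hasse`, PROVED; the sibling line
`hasse-pinning-fixed-level`'s `depthBound_of` ported).** Fixed-level congruence + least
distinguishing prime + small-prime depth ⟹ the depth bound: every common divisor `d` of the `c_p`,
`p ∈ Mult(W)`, is `≤ C_ε N^ε` on the crux class. For `d = ∏ ℓ^{m_ℓ}`: the `ℓ < ℓ₀` part is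
`≤ ∏_{ℓ<ℓ₀} B(ℓ)`; for `ℓ ≥ ℓ₀` group the prime powers by partner `W₀ ∈ S` — all those with partner
`W₀` divide the NON-ZERO integer `a_v(W) − a_v(W₀)` at the distinguishing prime `v = v(W, W₀)`,
whose size is `≤ 4v ≤ 4 C_{W₀} N^{ε'}` by Hasse; so `d ≤ B · ∏_{W₀ ∈ S} 4 C_{W₀} N^{ε'}`,
`ε' = ε/(#S + 1)`. `[folklore]` -/
theorem depthResidual_depthBound_of_hasse : (∃ ℓ₀ : ℕ, ∃ S : Finset (WeierstrassCurve ℚ), (∀ W₀ ∈ S, W₀.IsElliptic ∧ (∀ p ∈ (W₀.conductorNorm ℤ).primeFactors, p = 2) ∧ 2 ^ 2 ∣ W₀.conductorNorm ℤ) ∧ ∀ (ℓ m : ℕ), ℓ.Prime → ℓ₀ ≤ ℓ → 1 ≤ m → ∀ (W : WeierstrassCurve ℚ) [W.IsElliptic], (∀ p : ℕ, p.Prime → p ≠ 2 → ¬ p ^ 2 ∣ W.conductorNorm ℤ) → ((W.conductorNorm ℤ).primeFactors.filter (fun p => p ≠ 2 ∧ ¬ p ^ 2 ∣ W.conductorNorm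 ℤ)).card ≤ 3 → ((W.conductorNorm ℤ).primeFactors.filter (fun p => ¬ p ^ 2 ∣ W.conductorNorm ℤ)).Nonempty → (∀ p ∈ (W.conductorNorm ℤ).primeFactors.filter (fun p => ¬ p ^ 2 ∣ W.conductorNorm ℤ), 0 < (W.minimalDiscriminantNorm ℤ).factorization p) → (∀ p ∈ (W.conductorNorm ℤ).primeFactors.filter (fun p => ¬ p ^ 2 ∣ W.conductorNorm ℤ), ℓ ^ m ∣ (W.minimalDiscriminantNorm ℤ).factorization p) → ∃ W₀ ∈ S, ∀ v : ℕ, v.Prime → ¬ v ∣ 2 * W.conductorNorm ℤ → ((ℓ ^ m : ℕ) : ℤ) ∣ W.LFunction v - W₀.LFunction v) → (∀ (W₀ : WeierstrassCurve ℚ) [W₀.IsElliptic], (∀ p ∈ (W₀.conductorNorm ℤ).primeFactors, p = 2) → 2 ^ 2 ∣ W₀.conductorNorm ℤ → ∀ ε : ℝ, 0 < ε → ∃ C : ℝ, ∀ (W : WeierstrassCurve ℚ) [W.IsElliptic], (∀ p : ℕ, p.Prime → p ≠ 2 → ¬ p ^ 2 ∣ W.conductorNorm ℤ) → ((W.conductorNorm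 ℤ).primeFactors.filter (fun p => p ≠ 2 ∧ ¬ p ^ 2 ∣ W.conductorNorm ℤ)).card ≤ 3 → ((W.conductorNorm ℤ).primeFactors.filter (fun p => ¬ p ^ 2 ∣ W.conductorNorm ℤ)).Nonempty → ∃ v : ℕ, v.Prime ∧ ¬ v ∣ 2 * W.conductorNorm ℤ ∧ (v : ℝ) ≤ C * (W.conductorNorm ℤ : ℝ) ^ ε ∧ W.LFunction v ≠ W₀.LFunction v) → (∀ ℓ : ℕ, ℓ.Prime → ∃ B : ℝ, ∀ (W : WeierstrassCurve ℚ) [W.IsElliptic], (∀ p : ℕ, p.Prime → p ≠ 2 → ¬ p ^ 2 ∣ W.conductorNorm ℤ) → ((W.conductorNorm ℤ).primeFactors.filter (fun p => p ≠ 2 ∧ ¬ p ^ 2 ∣ W.conductorNorm ℤ)).card ≤ 3 → ((W.conductorNorm ℤ).primeFactors.filter (fun p => ¬ p ^ 2 ∣ W.conductorNorm ℤ)).Nonempty → (∀ p ∈ (W.conductorNorm ℤ).primeFactors.filter (fun p => ¬ p ^ 2 ∣ W.conductorNorm ℤ), 0 < (W.minimalDiscriminantNorm ℤ).factorization p) →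 ∀ m : ℕ, (∀ p ∈ (W.conductorNorm ℤ).primeFactors.filter (fun p => ¬ p ^ 2 ∣ W.conductorNorm ℤ), ℓ ^ m ∣ (W.minimalDiscriminantNorm ℤ).factorization p) → ((ℓ ^ m : ℕ) : ℝ) ≤ B) → ∀ ε : ℝ, 0 < ε → ∃ C : ℝ, ∀ (W : WeierstrassCurve ℚ) [W.IsElliptic], (∀ p : ℕ, p.Prime → p ≠ 2 → ¬ p ^ 2 ∣ W.conductorNorm ℤ) → ((W.conductorNorm ℤ).primeFactors.filter (fun p => p ≠ 2 ∧ ¬ p ^ 2 ∣ W.conductorNorm ℤ)).card ≤ 3 → ((W.conductorNorm ℤ).primeFactors.filter (fun p => ¬ p ^ 2 ∣ W.conductorNorm ℤ)).Nonempty → (∀ p ∈ (W.conductorNorm ℤ).primeFactors.filter (fun p => ¬ p ^ 2 ∣ W.conductorNorm ℤ), 0 < (W.minimalDiscriminantNorm ℤ).factorization p) → ∀ d : ℕ, (∀ p ∈ (W.conductorNorm ℤ).primeFactors.filter (fun p => ¬ p ^ 2 ∣ W.conductorNorm ℤ), d ∣ (W.minimalDiscriminantNorm ℤ).factorization p) →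 (d : ℝ) ≤ C * (W.conductorNorm ℤ : ℝ) ^ ε := by
  intro hcong hldp hsmall
  classical
  intro ε hε
  obtain ⟨ℓ₀, S, hS, hcong⟩ := hcong
  -- exponent budget
  set s : ℕ := S.card with hs
  set ε' : ℝ := ε / ((s : ℝ) + 1) with hε'
  have hε'pos : 0 < ε' := by positivity
  have hε's : ε' * (s : ℝ) ≤ ε := by
    rw [hε', div_mul_eq_mul_div, div_le_iff₀ (by positivity : (0 : ℝ) < (s : ℝ) + 1)]
    nlinarith [hε.le, (Nat.cast_nonneg s : (0 : ℝ) ≤ s)]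
  -- one constant per partner, from the least-distinguishing-prime statement at `ε'`
  have key3 : ∀ W₀ ∈ S, ∃ C : ℝ, 1 ≤ C ∧ ∀ (W : WeierstrassCurve ℚ) [W.IsElliptic],
      (∀ p : ℕ, p.Prime → p ≠ 2 → ¬ p ^ 2 ∣ W.conductorNorm ℤ) →
      ((W.conductorNorm ℤ).primeFactors.filter
        (fun p => p ≠ 2 ∧ ¬ p ^ 2 ∣ W.conductorNorm ℤ)).card ≤ 3 →
      ((W.conductorNorm ℤ).primeFactors.filter (fun p => ¬ p ^ 2 ∣ W.conductorNorm ℤ)).Nonempty →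
      ∃ v : ℕ, v.Prime ∧ ¬ v ∣ 2 * W.conductorNorm ℤ ∧
        (v : ℝ) ≤ C * (W.conductorNorm ℤ : ℝ) ^ ε' ∧ W.LFunction v ≠ W₀.LFunction v := by
    intro W₀ hW₀
    haveI := (hS W₀ hW₀).1
    obtain ⟨C, hC⟩ := hldp W₀ (hS W₀ hW₀).2.1 (hS W₀ hW₀).2.2 ε' hε'pos
    refine ⟨max C 1, le_max_right _ _, fun W _ hsf hcard hne => ?_⟩
    obtain ⟨v, hv, hvN, hvle, hne'⟩ := hC W hsf hcard hne
    refine ⟨v, hv, hvN, hvle.trans ?_, hne'⟩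
    exact mul_le_mul_of_nonneg_right (le_max_left _ _) (by positivity)
  choose! Cf hCf1 hCf using key3
  -- one constant per prime below `ℓ₀`, from the small-prime statement
  have key4 : ∀ ℓ ∈ (Finset.range ℓ₀).filter Nat.Prime, ∃ B : ℝ, 1 ≤ B ∧
      ∀ (W : WeierstrassCurve ℚ) [W.IsElliptic],
      (∀ p : ℕ, p.Prime → p ≠ 2 → ¬ p ^ 2 ∣ W.conductorNorm ℤ) →
      ((W.conductorNorm ℤ).primeFactors.filter
        (fun p => p ≠ 2 ∧ ¬ p ^ 2 ∣ W.conductorNorm ℤ)).card ≤ 3 →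
      ((W.conductorNorm ℤ).primeFactors.filter (fun p => ¬ p ^ 2 ∣ W.conductorNorm ℤ)).Nonempty →
      (∀ p ∈ (W.conductorNorm ℤ).primeFactors.filter (fun p => ¬ p ^ 2 ∣ W.conductorNorm ℤ),
        0 < (W.minimalDiscriminantNorm ℤ).factorization p) →
      ∀ m : ℕ,
        (∀ p ∈ (W.conductorNorm ℤ).primeFactors.filter (fun p => ¬ p ^ 2 ∣ W.conductorNorm ℤ),
          ℓ ^ m ∣ (W.minimalDiscriminantNorm ℤ).factorization p) →
        ((ℓ ^ m : ℕ) : ℝ) ≤ B := by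
    intro ℓ hℓ
    obtain ⟨B, hB⟩ := hsmall ℓ (Finset.mem_filter.mp hℓ).2
    refine ⟨max B 1, le_max_right _ _, fun W _ hsf hcard hne hpos m hm => ?_⟩
    exact (hB W hsf hcard hne hpos m hm).trans (le_max_left _ _)
  choose! Bf hBf1 hBf using key4
  set Bsm : ℝ := ∏ ℓ ∈ (Finset.range ℓ₀).filter Nat.Prime, Bf ℓ with hBsm
  have hBsm1 : 1 ≤ Bsm := by
    rw [hBsm]
    calc (1 : ℝ) = ∏ _ℓ ∈ (Finset.range ℓ₀).filter Nat.Prime, (1 : ℝ) :=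
          Finset.prod_const_one.symm
      _ ≤ _ := Finset.prod_le_prod (fun _ _ => zero_le_one) (fun ℓ hℓ => hBf1 ℓ hℓ)
  set CS : ℝ := ∏ W₀ ∈ S, (4 * Cf W₀) with hCS
  have hCS0 : 0 ≤ CS := by
    rw [hCS]
    exact Finset.prod_nonneg fun W₀ hW₀ => by linarith [hCf1 W₀ hW₀]
  refine ⟨Bsm * CS, ?_⟩
  intro W _ hsf hcard hne hpos d hd
  obtain ⟨p₀, hp₀⟩ := id hne
  have hNpos : 0 < W.conductorNorm ℤ := WeierstrassCurve.conductorNorm_pos_holds W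
  have hN1 : (1 : ℝ) ≤ (W.conductorNorm ℤ : ℝ) := by exact_mod_cast hNpos
  have hN0 : (0 : ℝ) < (W.conductorNorm ℤ : ℝ) := by linarith
  -- `d ≠ 0`
  have hd0 : d ≠ 0 := by
    rintro rfl
    have h0 := hd p₀ hp₀
    rw [zero_dvd_iff] at h0
    exact (hpos p₀ hp₀).ne' h0
  -- factor `d` and split its primes at `ℓ₀`
  have hdprod : ∏ ℓ ∈ d.primeFactors, ℓ ^ d.factorization ℓ = d := by
    have h := Nat.prod_factorization_pow_eq_self hd0
    rwa [Finsupp.prod, Nat.support_factorization] at h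
  set small := d.primeFactors.filter (fun ℓ => ℓ < ℓ₀) with hsmalldef
  set large := d.primeFactors.filter (fun ℓ => ¬ ℓ < ℓ₀) with hlargedef
  have hsplit : (∏ ℓ ∈ small, ℓ ^ d.factorization ℓ) * (∏ ℓ ∈ large, ℓ ^ d.factorization ℓ) = d := by
    rw [hsmalldef, hlargedef, Finset.prod_filter_mul_prod_filter_not, hdprod]
  have hpow_dvd : ∀ ℓ : ℕ, ∀ p ∈ (W.conductorNorm ℤ).primeFactors.filter
      (fun p => ¬ p ^ 2 ∣ W.conductorNorm ℤ),
      ℓ ^ d.factorization ℓ ∣ (W.minimalDiscriminantNorm ℤ).factorization p :=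
    fun ℓ p hp => (Nat.ordProj_dvd d ℓ).trans (hd p hp)
  -- the small part
  have hsmall_le : ((∏ ℓ ∈ small, ℓ ^ d.factorization ℓ : ℕ) : ℝ) ≤ Bsm := by
    rw [Nat.cast_prod]
    have h1 : ∀ ℓ ∈ small, ((ℓ ^ d.factorization ℓ : ℕ) : ℝ) ≤ Bf ℓ := by
      intro ℓ hℓ
      have hℓ' := Finset.mem_filter.mp hℓ
      have hmem : ℓ ∈ (Finset.range ℓ₀).filter Nat.Prime :=
        Finset.mem_filter.mpr ⟨Finset.mem_range.mpr hℓ'.2, Nat.prime_of_mem_primeFactors hℓ'.1⟩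
      exact hBf ℓ hmem W hsf hcard hne hpos (d.factorization ℓ) (hpow_dvd ℓ)
    have hsub : small ⊆ (Finset.range ℓ₀).filter Nat.Prime := fun ℓ hℓ => by
      have hℓ' := Finset.mem_filter.mp hℓ
      exact Finset.mem_filter.mpr ⟨Finset.mem_range.mpr hℓ'.2, Nat.prime_of_mem_primeFactors hℓ'.1⟩
    have hrest : (1 : ℝ) ≤ ∏ ℓ ∈ ((Finset.range ℓ₀).filter Nat.Prime) \ small, Bf ℓ := by
      calc (1 : ℝ) = ∏ _ℓ ∈ ((Finset.range ℓ₀).filter Nat.Prime) \ small, (1 : ℝ) :=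
            Finset.prod_const_one.symm
        _ ≤ _ := Finset.prod_le_prod (fun _ _ => zero_le_one)
            (fun ℓ hℓ => hBf1 ℓ (Finset.mem_sdiff.mp hℓ).1)
    calc ∏ ℓ ∈ small, ((ℓ ^ d.factorization ℓ : ℕ) : ℝ) ≤ ∏ ℓ ∈ small, Bf ℓ :=
          Finset.prod_le_prod (fun _ _ => by positivity) h1
      _ ≤ (∏ ℓ ∈ ((Finset.range ℓ₀).filter Nat.Prime) \ small, Bf ℓ) * ∏ ℓ ∈ small, Bf ℓ :=
          le_mul_of_one_le_left (Finset.prod_nonneg fun ℓ hℓ => by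
            linarith [hBf1 ℓ (hsub hℓ)]) hrest
      _ = Bsm := by rw [hBsm, Finset.prod_sdiff hsub]
  -- the large part: partners and distinguishing primes
  have hlarge_mem : ∀ ℓ ∈ large, ℓ.Prime ∧ ℓ₀ ≤ ℓ ∧ 1 ≤ d.factorization ℓ := by
    intro ℓ hℓ
    have hℓ' := Finset.mem_filter.mp hℓ
    have hℓp : ℓ.Prime := Nat.prime_of_mem_primeFactors hℓ'.1
    exact ⟨hℓp, not_lt.mp hℓ'.2,
      hℓp.factorization_pos_of_dvd hd0 (Nat.dvd_of_mem_primeFactors hℓ'.1)⟩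
  have key2 : ∀ ℓ ∈ large, ∃ W₀ ∈ S, ∀ v : ℕ, v.Prime → ¬ v ∣ 2 * W.conductorNorm ℤ →
      ((ℓ ^ d.factorization ℓ : ℕ) : ℤ) ∣ W.LFunction v - W₀.LFunction v := by
    intro ℓ hℓ
    obtain ⟨hℓp, hℓ₀, hm⟩ := hlarge_mem ℓ hℓ
    exact hcong ℓ (d.factorization ℓ) hℓp hℓ₀ hm W hsf hcard hne hpos (hpow_dvd ℓ)
  haveI : Nonempty (WeierstrassCurve ℚ) := ⟨W⟩
  choose! π hπS hπ using key2
  have key3W : ∀ W₀ ∈ S, ∃ v : ℕ, v.Prime ∧ ¬ v ∣ 2 * W.conductorNorm ℤ ∧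
      (v : ℝ) ≤ Cf W₀ * (W.conductorNorm ℤ : ℝ) ^ ε' ∧ W.LFunction v ≠ W₀.LFunction v :=
    fun W₀ hW₀ => hCf W₀ hW₀ W hsf hcard hne
  choose! vf hvp hvN hvle hvne using key3W
  -- the non-zero integer `a_v(W) − a_v(W₀)` and its size
  have hD : ∀ W₀ ∈ S, (W.LFunction (vf W₀) - W₀.LFunction (vf W₀)).natAbs ≠ 0 ∧
      (((W.LFunction (vf W₀) - W₀.LFunction (vf W₀)).natAbs : ℕ) : ℝ) ≤
        4 * Cf W₀ * (W.conductorNorm ℤ : ℝ) ^ ε' := by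
    intro W₀ hW₀
    haveI := (hS W₀ hW₀).1
    refine ⟨Int.natAbs_ne_zero.mpr (sub_ne_zero.mpr (hvne W₀ hW₀)), ?_⟩
    rw [Nat.cast_natAbs, Int.cast_abs, Int.cast_sub]
    have h1 := depthResidual_abs_LFunction_prime_le W (hvp W₀ hW₀)
    have h2 := depthResidual_abs_LFunction_prime_le W₀ (hvp W₀ hW₀)
    have h3 := hvle W₀ hW₀
    calc |((W.LFunction (vf W₀) : ℤ) : ℝ) - ((W₀.LFunction (vf W₀) : ℤ) : ℝ)|
        ≤ |((W.LFunction (vf W₀) : ℤ) : ℝ)| + |((W₀.LFunction (vf W₀) : ℤ) : ℝ)| := abs_sub _ _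
      _ ≤ 2 * (vf W₀ : ℝ) + 2 * (vf W₀ : ℝ) := add_le_add h1 h2
      _ = 4 * (vf W₀ : ℝ) := by ring
      _ ≤ 4 * (Cf W₀ * (W.conductorNorm ℤ : ℝ) ^ ε') := by linarith
      _ = 4 * Cf W₀ * (W.conductorNorm ℤ : ℝ) ^ ε' := by ring
  -- group the large prime powers by partner
  have hlarge_eq : ∏ ℓ ∈ large, ℓ ^ d.factorization ℓ =
      ∏ W₀ ∈ S, ∏ ℓ ∈ large.filter (fun ℓ => π ℓ = W₀), ℓ ^ d.factorization ℓ :=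
    (Finset.prod_fiberwise_of_maps_to (fun ℓ hℓ => hπS ℓ hℓ) _).symm
  have hinner : ∀ W₀ ∈ S,
      ((∏ ℓ ∈ large.filter (fun ℓ => π ℓ = W₀), ℓ ^ d.factorization ℓ : ℕ) : ℝ) ≤
        4 * Cf W₀ * (W.conductorNorm ℤ : ℝ) ^ ε' := by
    intro W₀ hW₀
    obtain ⟨hD0, hDle⟩ := hD W₀ hW₀
    refine le_trans ?_ hDle
    have hdvd : ∏ ℓ ∈ large.filter (fun ℓ => π ℓ = W₀), ℓ ^ d.factorization ℓ ∣
        (W.LFunction (vf W₀) - W₀.LFunction (vf W₀)).natAbs := by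
      refine depthResidual_prod_primePow_dvd
        (fun ℓ hℓ => (hlarge_mem ℓ (Finset.mem_filter.mp hℓ).1).1)
        (fun ℓ => d.factorization ℓ) hD0 (fun ℓ hℓ => ?_)
      have hℓ' := Finset.mem_filter.mp hℓ
      have h := hπ ℓ hℓ'.1 (vf W₀) (hvp W₀ hW₀) (hvN W₀ hW₀)
      rw [hℓ'.2] at h
      exact Int.natCast_dvd.mp h
    exact_mod_cast Nat.le_of_dvd (Nat.pos_of_ne_zero hD0) hdvd
  have hlarge_le : ((∏ ℓ ∈ large, ℓ ^ d.factorization ℓ : ℕ) : ℝ) ≤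
      CS * (W.conductorNorm ℤ : ℝ) ^ (ε' * (s : ℝ)) := by
    rw [hlarge_eq, Nat.cast_prod]
    calc ∏ W₀ ∈ S, ((∏ ℓ ∈ large.filter (fun ℓ => π ℓ = W₀), ℓ ^ d.factorization ℓ : ℕ) : ℝ)
        ≤ ∏ W₀ ∈ S, (4 * Cf W₀ * (W.conductorNorm ℤ : ℝ) ^ ε') :=
          Finset.prod_le_prod (fun _ _ => by positivity) hinner
      _ = CS * ((W.conductorNorm ℤ : ℝ) ^ ε') ^ s := by
          rw [Finset.prod_mul_distrib, Finset.prod_const, hCS]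
      _ = CS * (W.conductorNorm ℤ : ℝ) ^ (ε' * (s : ℝ)) := by
          rw [← Real.rpow_natCast, ← Real.rpow_mul hN0.le]
  -- combine
  have hd_eq : (d : ℝ) = ((∏ ℓ ∈ small, ℓ ^ d.factorization ℓ : ℕ) : ℝ) *
      ((∏ ℓ ∈ large, ℓ ^ d.factorization ℓ : ℕ) : ℝ) := by
    rw [← Nat.cast_mul, hsplit]
  rw [hd_eq]
  calc ((∏ ℓ ∈ small, ℓ ^ d.factorization ℓ : ℕ) : ℝ) *
        ((∏ ℓ ∈ large, ℓ ^ d.factorization ℓ : ℕ) : ℝ)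
      ≤ Bsm * (CS * (W.conductorNorm ℤ : ℝ) ^ (ε' * (s : ℝ))) :=
        mul_le_mul hsmall_le hlarge_le (by positivity) (by linarith)
    _ = (Bsm * CS) * (W.conductorNorm ℤ : ℝ) ^ (ε' * (s : ℝ)) := by ring
    _ ≤ (Bsm * CS) * (W.conductorNorm ℤ : ℝ) ^ ε := by
        apply mul_le_mul_of_nonneg_left _ (by positivity)
        exact Real.rpow_le_rpow_of_exponent_le hN1 hε's

/-- **The depth bound ⟹ the stub (registered sub-goal `stub_depthResidual_of_depthBound`,
PROVED).** Apply the bound on all common divisors to `d := G(W) = gcd_{p ∈ Mult(W)} c_p`, which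
divides every `c_p`, `p ∈ Mult(W)` (`Finset.gcd_dvd`); the positivity `0 < c_p` on `Mult(W)`
required by the hypothesis holds for every elliptic `W` (`depthResidual_factorization_pos`). The
hypotheses `¬ Squarefree N` and "`W` is not a twist of a Frey curve" are not used: the depth bound
is stated on the whole class. `[folklore]` -/
theorem stub_depthResidual_of_depthBound : (∀ ε : ℝ, 0 < ε → ∃ C : ℝ, ∀ (W : WeierstrassCurve ℚ) [W.IsElliptic], (∀ p : ℕ, p.Prime → p ≠ 2 → ¬ p ^ 2 ∣ W.conductorNorm ℤ) → ((W.conductorNorm ℤ).primeFactors.filter (fun p => p ≠ 2 ∧ ¬ p ^ 2 ∣ W.conductorNorm ℤ)).card ≤ 3 → ((W.conductorNorm ℤ).primeFactors.filter (fun p => ¬ p ^ 2 ∣ W.conductorNorm ℤ)).Nonempty → (∀ p ∈ (W.conductorNorm ℤ).primeFactors.filter (fun p => ¬ p ^ 2 ∣ W.conductorNorm ℤ), 0 < (W.minimalDiscriminantNorm ℤ).factorization p) → ∀ d : ℕ, (∀ p ∈ (W.conductorNorm ℤ).primeFactors.filter (fun p => ¬ p ^ 2 ∣ W.conductorNorm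 ℤ), d ∣ (W.minimalDiscriminantNorm ℤ).factorization p) → (d : ℝ) ≤ C * (W.conductorNorm ℤ : ℝ) ^ ε) → ∀ ε : ℝ, 0 < ε → ∃ C : ℝ, ∀ (W : WeierstrassCurve ℚ) [W.IsElliptic], (∀ p : ℕ, p.Prime → p ≠ 2 → ¬ p ^ 2 ∣ W.conductorNorm ℤ) → ((W.conductorNorm ℤ).primeFactors.filter (fun p => p ≠ 2 ∧ ¬ p ^ 2 ∣ W.conductorNorm ℤ)).card ≤ 3 → ¬ Squarefree (W.conductorNorm ℤ) → (¬ ∃ (a b d : ℤ) (C : WeierstrassCurve.VariableChange ℚ), IsCoprime a b ∧ a * b * (a + b) ≠ 0 ∧ d ∣ 2 ∧ C • W = Literature.NumberTheory.EllipticCurves.freyCurve (d * a) (d * b)) → ((W.conductorNorm ℤ).primeFactors.filter (fun p => ¬ p ^ 2 ∣ W.conductorNorm ℤ)).Nonempty → ((((W.conductorNorm ℤ).primeFactors.filter (fun p => ¬ p ^ 2 ∣ W.conductorNorm ℤ)).gcd (fun p => (W.minimalDiscriminantNorm ℤ).factorization p) : ℕ) : ℝ) ≤ C * (W.conductorNorm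 ℤ : ℝ) ^ ε := by
  intro hdepth ε hε
  obtain ⟨C, hC⟩ := hdepth ε hε
  refine ⟨C, ?_⟩
  intro W _ hsf hcard _hnsq _hnfrey hne
  exact hC W hsf hcard hne (fun p hp => depthResidual_factorization_pos W hp) _
    (fun p hp => Finset.gcd_dvd hp)

/-- **`stub_depthResidual` from the hasse-pinning depth half (registered sub-goal
`stub_depthResidual_of_hasse`, PROVED).** Fixed-level congruence → least distinguishing prime →
small-prime depth → the stub: the composition of `depthResidual_depthBound_of_hasse` and
`stub_depthResidual_of_depthBound`. `[folklore]` -/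
theorem stub_depthResidual_of_hasse : (∃ ℓ₀ : ℕ, ∃ S : Finset (WeierstrassCurve ℚ), (∀ W₀ ∈ S, W₀.IsElliptic ∧ (∀ p ∈ (W₀.conductorNorm ℤ).primeFactors, p = 2) ∧ 2 ^ 2 ∣ W₀.conductorNorm ℤ) ∧ ∀ (ℓ m : ℕ), ℓ.Prime → ℓ₀ ≤ ℓ → 1 ≤ m → ∀ (W : WeierstrassCurve ℚ) [W.IsElliptic], (∀ p : ℕ, p.Prime → p ≠ 2 → ¬ p ^ 2 ∣ W.conductorNorm ℤ) → ((W.conductorNorm ℤ).primeFactors.filter (fun p => p ≠ 2 ∧ ¬ p ^ 2 ∣ W.conductorNorm ℤ)).card ≤ 3 → ((W.conductorNorm ℤ).primeFactors.filter (fun p => ¬ p ^ 2 ∣ W.conductorNorm ℤ)).Nonempty → (∀ p ∈ (W.conductorNorm ℤ).primeFactors.filter (fun p => ¬ p ^ 2 ∣ W.conductorNorm ℤ), 0 < (W.minimalDiscriminantNorm ℤ).factorization p) → (∀ p ∈ (W.conductorNorm ℤ).primeFactors.filter (fun p => ¬ p ^ 2 ∣ W.conductorNorm ℤ), ℓ ^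 m ∣ (W.minimalDiscriminantNorm ℤ).factorization p) → ∃ W₀ ∈ S, ∀ v : ℕ, v.Prime → ¬ v ∣ 2 * W.conductorNorm ℤ → ((ℓ ^ m : ℕ) : ℤ) ∣ W.LFunction v - W₀.LFunction v) → (∀ (W₀ : WeierstrassCurve ℚ) [W₀.IsElliptic], (∀ p ∈ (W₀.conductorNorm ℤ).primeFactors, p = 2) → 2 ^ 2 ∣ W₀.conductorNorm ℤ → ∀ ε : ℝ, 0 < ε → ∃ C : ℝ, ∀ (W : WeierstrassCurve ℚ) [W.IsElliptic], (∀ p : ℕ, p.Prime → p ≠ 2 → ¬ p ^ 2 ∣ W.conductorNorm ℤ) → ((W.conductorNorm ℤ).primeFactors.filter (fun p => p ≠ 2 ∧ ¬ p ^ 2 ∣ W.conductorNorm ℤ)).card ≤ 3 → ((W.conductorNorm ℤ).primeFactors.filter (fun p => ¬ p ^ 2 ∣ W.conductorNorm ℤ)).Nonempty → ∃ v : ℕ, v.Prime ∧ ¬ v ∣ 2 * W.conductorNorm ℤ ∧ (v : ℝ) ≤ C * (W.conductorNorm ℤ : ℝ) ^ ε ∧ W.LFunction v ≠ W₀.LFunction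 v) → (∀ ℓ : ℕ, ℓ.Prime → ∃ B : ℝ, ∀ (W : WeierstrassCurve ℚ) [W.IsElliptic], (∀ p : ℕ, p.Prime → p ≠ 2 → ¬ p ^ 2 ∣ W.conductorNorm ℤ) → ((W.conductorNorm ℤ).primeFactors.filter (fun p => p ≠ 2 ∧ ¬ p ^ 2 ∣ W.conductorNorm ℤ)).card ≤ 3 → ((W.conductorNorm ℤ).primeFactors.filter (fun p => ¬ p ^ 2 ∣ W.conductorNorm ℤ)).Nonempty → (∀ p ∈ (W.conductorNorm ℤ).primeFactors.filter (fun p => ¬ p ^ 2 ∣ W.conductorNorm ℤ), 0 < (W.minimalDiscriminantNorm ℤ).factorization p) → ∀ m : ℕ, (∀ p ∈ (W.conductorNorm ℤ).primeFactors.filter (fun p => ¬ p ^ 2 ∣ W.conductorNorm ℤ), ℓ ^ m ∣ (W.minimalDiscriminantNorm ℤ).factorization p) → ((ℓ ^ m : ℕ) : ℝ) ≤ B) → ∀ ε : ℝ, 0 < ε → ∃ C : ℝ, ∀ (W : WeierstrassCurve ℚ) [W.IsElliptic], (∀ p : ℕ, p.Prime → p ≠ 2 → ¬ p ^ 2 ∣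 W.conductorNorm ℤ) → ((W.conductorNorm ℤ).primeFactors.filter (fun p => p ≠ 2 ∧ ¬ p ^ 2 ∣ W.conductorNorm ℤ)).card ≤ 3 → ¬ Squarefree (W.conductorNorm ℤ) → (¬ ∃ (a b d : ℤ) (C : WeierstrassCurve.VariableChange ℚ), IsCoprime a b ∧ a * b * (a + b) ≠ 0 ∧ d ∣ 2 ∧ C • W = Literature.NumberTheory.EllipticCurves.freyCurve (d * a) (d * b)) → ((W.conductorNorm ℤ).primeFactors.filter (fun p => ¬ p ^ 2 ∣ W.conductorNorm ℤ)).Nonempty → ((((W.conductorNorm ℤ).primeFactors.filter (fun p => ¬ p ^ 2 ∣ W.conductorNorm ℤ)).gcd (fun p => (W.minimalDiscriminantNorm ℤ).factorization p) : ℕ) : ℝ) ≤ C * (W.conductorNorm ℤ : ℝ) ^ ε :=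
  fun h1 h2 h3 => stub_depthResidual_of_depthBound (depthResidual_depthBound_of_hasse h1 h2 h3)

end Summit.ABC.ABC.Theorems.FewPrimeValuationProduct
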